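import Summits.AnomalousDissipation.AnomalousDissipation.Theses.DebrisQuanta

/-!
# Crux `RecurrentDebris` (stmt-AnomalousDissipation-2858, route DebrisQuanta, rank 2) — birth skeleton

`Lines/birth.lean` (BC3): three NAMED stubs and the kernel-checked composition
`RecurrentDebris_of : stub₁ → stub₂ → stub₃ → RecurrentDebris` concluding the route decl
`Summit.AnomalousDissipation.AnomalousDissipation.Theses.DebrisQuanta.RecurrentDebris` BY NAME
(hypotheses = the name-keyed aliases `__Registered.stub_*`, textually the stub signatures; sorries
only inside the three `stub_*`; wiring `example` at the end).

## The crux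

`RecurrentDebris`: there are an exponent `2/3 < α < 1`, an admissible profile potential `W`, a smooth
steady divergence-free mean-zero force `f`, constants `M c L E`, viscosities `ν_j → 0⁺`, data `u₀ j`
and GLOBAL Leray–Hopf solutions `u_j` (force `f`) with (E) `sup_{t ≥ 0} kineticEnergy (u_j t) ≤ E`
and (R) every window `[T, T+L]`, `T ≥ 0`, contains a time `t` FROM WHICH THE ENERGY INEQUALITY
HOLDS at which `u_j t = b + D_{α,W}(· − a) + w`: `b` a calm background (`|b|, |∇b| ≤ M`), `a` the
collapse point, `‖w‖_{L²} ≤ c·ν_j^{(3−2α)/(2(1−α))}` (the energy `D_{α,W}` carries below the arrest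
scale `λ_j = ν_j^{1/(1−α)}`), `D_{α,W} = curl[χ(|z|)|z|^{1−α} W(z/|z|)]` at `z = repr x − (½,½,½)`.

## The cut: RECURRENCE (open, blow-up class) ∣ ENERGY OF A DEBRIS STATE ∣ ENERGY BETWEEN VISITS

The crux conjoins two clauses of different status. (R) — recurrent, `ν`-uniform arrested
`α`-collapse of a smooth-forced flow — is the Euler-blow-up-class content nobody can prove today.
(E) — the `ν`-UNIFORM energy ceiling the summit's bounded-energy clause needs — is NOT automatic for
forced Navier–Stokes (laminar families have energy `~ν⁻²`; cf. the refuted universal ceiling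
GPEnergyCeiling, stmt-AnomalousDissipation-2979), but it FOLLOWS from (R): a flow that returns, in
every window of length `L`, to a state of bounded energy at a time from which the energy inequality
holds cannot gain more than `O(L‖f‖)` in `L²`-norm in between (energy inequality + Cauchy–Schwarz on
the work term + a bootstrap over one window), uniformly in `ν`. The skeleton files (E) as two
PROVABLE-NOW lemmas and leaves (R) as the single named residue, stated `ν`-by-`ν` (a continuum
family over `0 < ν ≤ ν₀`, from data of bounded energy) rather than along a sequence:

* `stub_debrisCycle` (the residue; open, blow-up class, XL): `∃ α W f M c L K ν₀` such that for
  EVERY `0 < ν ≤ ν₀` some global Leray–Hopf solution from a datum of energy `≤ K` makes a debris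
  visit (good time, calm background `M`, tolerance `c ν^{(3−2α)/(2(1−α))}`) in every window
  `[T, T+L]`. No energy ceiling is asked. Why it might fail = why the crux might (needs `ν`-uniform
  recurrent collapse to a `|y|^{−α}` cusp, beyond every known blow-up scenario; K2 of the route: an
  a-priori bound `‖∇u‖_∞ ≤ C(f,E) ν^{−k}` kills it for `α > (k−1)/(k+1)`).
* `stub_debrisStateEnergy` (provable now, M): a debris state has energy bounded by a constant
  `K(α, W, M, c)`, uniformly in `0 < ν ≤ 1`: `‖v‖₂ ≤ ‖b‖₂ + ‖D_{α,W}‖₂ + max(c,0)^{…}` — the content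
  is `D_{α,W} ∈ L²(T³)` (`|D| ≲ |z|^{−α}`, `α < 1 < 3/2`; the route's support item DebrisDatumRegular,
  stmt-AnomalousDissipation-2862, records the same fact) plus the triangle inequality.
* `stub_energyBetweenVisits` (provable now, M–L): for a smooth steady force `f`, window length `L`
  and level `K` there is `E = E(f, L, K)` such that EVERY global Leray–Hopf solution at ANY `ν > 0`
  from a datum of energy `≤ K` which meets, in every window `[T, T+L]`, a time from which the energy
  inequality holds and at which the energy is `≤ K`, has `kineticEnergy (u t) ≤ E` for all `t ≥ 0`.
  Proof in print: from the last control time `t₀ ≤ t ≤ t₀ + L` (or from `0`),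
  `‖u(s)‖₂² ≤ 2K + 2∫_{t₀}^{s} ‖f‖_∞ ‖u(τ)‖₂ dτ`; `m := sup_{[t₀,t₀+L]} ‖u‖₂` is finite a priori
  (`L^∞_t L²_x` bound of the solution) and satisfies `m² ≤ 2K + 2L‖f‖_∞ m`, whence
  `m ≤ L‖f‖_∞ + (L²‖f‖_∞² + 2K)^{1/2}` — independent of `ν` and of the solution. (Junk-safe: a
  non-integrable work term makes the interval integral `0`, and the slice `u 0` obeys
  `KE (u 0) ≤ KE u₀` by `energy_ineq_zero`.)

Composition (`RecurrentDebris_of`, no sorry): take the data of stub 1; `K₁` from stub 2 at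
`(α, W, M, c)`; `K₂ := max K K₁`; `E` from stub 3 at `(f, L, K₂)`; the sequence
`ν_j := min ν₀ 1 / (j + 1) → 0⁺` (`≤ ν₀`, `≤ 1`); `choose` the solutions of stub 1 along `ν_j`; the
energy clause (E) is stub 3 fed, window by window, with the visits of stub 1 whose energy stub 2 bounds
(the slice `u_j t`, `t ≥ 0`, is in `L²` by `IsLerayHopfOn.memLp`); the recurrence clause (R) is stub 1's.

Disproof used: none relevant — `ledger crux ls stmt-AnomalousDissipation-2858`: no workfiles (no
`Disproof.lean`, no `Negative/` lemma) at registration. Negatives index (6 refuted statements of the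
summit, 2026-08-17): the two that touch this line are honoured — GPEnergyCeiling (2979: a UNIVERSAL
`ν`-uniform energy ceiling over all Leray–Hopf solutions is false) is exactly why (E) is derived from
recurrence and not asserted for all solutions; RobustDecayQuantum (2859: the `t = 0` slice of
`Torus.IsLerayHopfOn` is junk) does not bite: stub 3's conclusion at `t = 0` is guarded by
`energy_ineq_zero` (`KE (u 0) ≤ KE u₀ ≤ K`) and its hypotheses enter only through energies.

Hardest stub: `stub_debrisCycle` (it is the crux's open content; sources BronziShvydkoy2015,
Chae2007, Elgindi2021, ChenHou2023, arXiv:2309.08495, BrueDeLellis2023, Shvydkoy2017). The two energy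
stubs lean on `Literature.Analysis.FluidPDE.Torus.IsLerayHopfOn.{energy_ineq_zero, energy_bound,
memLp}`, `Literature.Analysis.FunctionSpaces.Torus.kineticEnergy_nonneg`, Hölder on the unit torus,
and (stub 2) `measurable_fderiv` + the `|z|^{−α}` bound for the truncated homogeneous potential
(DoeringFoias2002 §2 for the energy bookkeeping; Hopf1951 / Galdi2000 Def. 2.1 for the class).
-/

-- `Summit.<Summit>.<Problem>`: single-conjunct summit, the duplicate component is the tree's convention.
set_option linter.dupNamespace false

noncomputable section

open Filter Set MeasureTheory Topology

namespace Summit.AnomalousDissipation.AnomalousDissipation.Cruxes.RecurrentDebris.Birth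

/-- **stub 1 — RECURRENT ARRESTED COLLAPSE, `ν`-BY-`ν` (the residue of the crux; open, Euler-blow-up
class, size XL).** There are `2/3 < α < 1`, an admissible profile potential `W` (smooth, with
`curl(|z|^{1−α} W(ẑ)) ≢ 0`), a smooth steady divergence-free mean-zero force `f` and constants
`M c L K ν₀` (`L, ν₀ > 0`) such that for EVERY viscosity `0 < ν ≤ ν₀` some global Leray–Hopf solution
`u` (force `f`) from a datum `u₀` of energy `≤ K` visits, in every window `[T, T+L]` (`T ≥ 0`), a
DEBRIS STATE at a time `t` from which the energy inequality holds:
`u t = b + D_{α,W}(· − a) + w`, `b` smooth divergence-free with `|lift b|, ‖D(lift b)‖ ≤ M`,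
`‖w‖_{L²} ≤ c·ν^{(3−2α)/(2(1−α))}`. No energy ceiling is part of this stub (that is stubs 2–3).
Why it might fail: needs `ν`-uniform RECURRENT collapse to a `|y|^{−α}` cusp in bounded-energy
smooth-forced flow on `T³`, beyond all known blow-ups (Elgindi2021: `C^{1,a}` data; ChenHou2023:
boundary; arXiv:2309.08495: rough force, one event); locally self-similar collapse mostly excluded
(Chae2007, BronziShvydkoy2015 Rem 1.3); an a-priori gradient bound polynomial in `ν⁻¹` for
bounded-energy forced families refutes it for `α` close to `1` (route kill criterion K2).
Sources: BronziShvydkoy2015, Chae2007, Elgindi2021, ChenHou2023, arXiv:2309.08495, BrueDeLellis2023,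
Shvydkoy2017. -/
theorem stub_debrisCycle :
    ∃ (α : ℝ) (W : EuclideanSpace ℝ (Fin 3) → EuclideanSpace ℝ (Fin 3)) (f : UnitAddTorus (Fin 3) → EuclideanSpace ℝ (Fin 3)) (M c L K ν₀ : ℝ), 2/3 < α ∧ α < 1 ∧ (ContDiff ℝ ((⊤ : ℕ∞) : WithTop ℕ∞) W ∧ ∃ y : EuclideanSpace ℝ (Fin 3), y ≠ 0 ∧ Literature.Analysis.FluidPDE.curl (fun z : EuclideanSpace ℝ (Fin 3) => (‖z‖ ^ (1 - α)) • W (‖z‖⁻¹ • z)) y ≠ 0) ∧ Literature.Analysis.FunctionSpaces.Torus.IsSmooth f ∧ Literature.Analysis.FunctionSpaces.Torus.IsDivFree f ∧ Literature.Analysis.FunctionSpaces.Torus.HasZeroMean f ∧ 0 < L ∧ 0 < ν₀ ∧ ∀ ν : ℝ, 0 < ν → ν ≤ ν₀ → ∃ (u₀ : UnitAddTorus (Fin 3) → EuclideanSpace ℝ (Fin 3)) (u : ℝ → UnitAddTorus (Fin 3) → EuclideanSpace ℝ (Fin 3)), Literature.Analysis.FluidPDE.Torus.IsGlobalLerayHopf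 ν (fun _ => f) u₀ u ∧ Literature.Analysis.FunctionSpaces.Torus.kineticEnergy u₀ ≤ K ∧ ∀ T : ℝ, 0 ≤ T → ∃ t ∈ Set.Icc T (T + L), ∃ (a : UnitAddTorus (Fin 3)) (b : UnitAddTorus (Fin 3) → EuclideanSpace ℝ (Fin 3)), (∀ s : ℝ, t ≤ s → Literature.Analysis.FunctionSpaces.Torus.kineticEnergy (u s) + ν * (∫⁻ τ in Set.Ioo t s, Literature.Analysis.FunctionSpaces.Torus.eGradNormSq (u τ)).toReal ≤ Literature.Analysis.FunctionSpaces.Torus.kineticEnergy (u t) + ∫ τ in t..s, ∫ x, inner ℝ (f x) (u τ x)) ∧ (Literature.Analysis.FunctionSpaces.Torus.IsSmooth b ∧ Literature.Analysis.FunctionSpaces.Torus.IsDivFree b ∧ ∀ y : EuclideanSpace ℝ (Fin 3), ‖Literature.Analysis.FunctionSpaces.Torus.lift b y‖ ≤ M ∧ ‖fderiv ℝ (Literature.Analysis.FunctionSpaces.Torus.lift b) y‖ ≤ M) ∧ MeasureTheory.eLpNorm (fun x => u t x - b x - Literature.Analysis.FluidPDE.curl (fun z : EuclideanSpace ℝ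 (Fin 3) => (Real.smoothTransition (2 - 8 * ‖z‖) * ‖z‖ ^ (1 - α)) • W (‖z‖⁻¹ • z)) (Literature.Analysis.FunctionSpaces.Torus.repr (x - a) - (!₂[(1:ℝ)/2, 1/2, 1/2] : EuclideanSpace ℝ (Fin 3)))) 2 MeasureTheory.volume ≤ ENNReal.ofReal (c * ν ^ ((3 - 2 * α) / (2 * (1 - α)))) := by
  sorry

/-- **stub 2 — A DEBRIS STATE HAS `ν`-UNIFORMLY BOUNDED ENERGY (provable now, size M).** For
`α < 1`, an admissible profile `W` and constants `M, c` there is `K = K(α, W, M, c)` such that every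
`L²` field `v` on `T³` within `c·ν^{(3−2α)/(2(1−α))}` (`0 < ν ≤ 1`) of `b + D_{α,W}(· − a)`, `b` a calm
background of size `M`, has `kineticEnergy v ≤ K`. Why true: `‖v‖₂ ≤ ‖b‖₂ + ‖D_{α,W}(· − a)‖₂ + ‖w‖₂`
with `‖b‖₂ ≤ M` (torus of volume one), `‖w‖₂ ≤ max(c,0)` (`ν^{p} ≤ 1` for the positive exponent
`p = (3−2α)/(2(1−α))`), and `D_{α,W} ∈ L²(T³)`: the potential `χ(|z|)|z|^{1−α}W(ẑ)` is smooth off the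
centre with `|∇Φ(z)| ≲ |z|^{−α}` (`W` bounded with bounded derivative on the unit sphere), square
integrable near `0` for `α < 3/2`, compactly supported in the fundamental cube; measurability of
`x ↦ curl Φ (repr (x − a) − centre)` from `measurable_fderiv` and the measurable `repr`. Leans on:
`MeasureTheory.eLpNorm_add_le`, `Literature.Analysis.FunctionSpaces.Torus.kineticEnergy`,
the route's support item DebrisDatumRegular (stmt-AnomalousDissipation-2862, `MemLp (D α W) 2`).
Why it might fail: it should not; the Lean cost is the `|z|^{−α}` derivative bound for a general
smooth `W`. Sources: Shvydkoy2017 (homogeneous fields `|x|^{−α}V`), BronziShvydkoy2015 Rem 1.2. -/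
theorem stub_debrisStateEnergy :
    ∀ (α : ℝ) (W : EuclideanSpace ℝ (Fin 3) → EuclideanSpace ℝ (Fin 3)) (M c : ℝ), α < 1 → (ContDiff ℝ ((⊤ : ℕ∞) : WithTop ℕ∞) W ∧ ∃ y : EuclideanSpace ℝ (Fin 3), y ≠ 0 ∧ Literature.Analysis.FluidPDE.curl (fun z : EuclideanSpace ℝ (Fin 3) => (‖z‖ ^ (1 - α)) • W (‖z‖⁻¹ • z)) y ≠ 0) → ∃ K : ℝ, ∀ (ν : ℝ) (v : UnitAddTorus (Fin 3) → EuclideanSpace ℝ (Fin 3)) (a : UnitAddTorus (Fin 3)) (b : UnitAddTorus (Fin 3) → EuclideanSpace ℝ (Fin 3)), 0 < ν → ν ≤ 1 → MeasureTheory.MemLp v 2 MeasureTheory.volume → (Literature.Analysis.FunctionSpaces.Torus.IsSmooth b ∧ Literature.Analysis.FunctionSpaces.Torus.IsDivFree b ∧ ∀ y : EuclideanSpace ℝ (Fin 3), ‖Literature.Analysis.FunctionSpaces.Torus.lift b y‖ ≤ M ∧ ‖fderiv ℝ (Literature.Analysis.FunctionSpaces.Torus.lift b) y‖ ≤ M)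 → MeasureTheory.eLpNorm (fun x => v x - b x - Literature.Analysis.FluidPDE.curl (fun z : EuclideanSpace ℝ (Fin 3) => (Real.smoothTransition (2 - 8 * ‖z‖) * ‖z‖ ^ (1 - α)) • W (‖z‖⁻¹ • z)) (Literature.Analysis.FunctionSpaces.Torus.repr (x - a) - (!₂[(1:ℝ)/2, 1/2, 1/2] : EuclideanSpace ℝ (Fin 3)))) 2 MeasureTheory.volume ≤ ENNReal.ofReal (c * ν ^ ((3 - 2 * α) / (2 * (1 - α)))) → Literature.Analysis.FunctionSpaces.Torus.kineticEnergy v ≤ K := by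
  sorry

/-- **stub 3 — ENERGY BETWEEN VISITS: recurrence at good low-energy times gives a `ν`-UNIFORM energy
ceiling (provable now, size M–L).** For a smooth steady force `f`, a window length `L > 0` and a level
`K` there is `E = E(f, L, K)` such that for EVERY viscosity `ν > 0` and every global Leray–Hopf solution
`u` (force `f`) from a datum `u₀` with `kineticEnergy u₀ ≤ K` which has, in every window `[T, T+L]`
(`T ≥ 0`), a time `t` from which the energy inequality holds and at which `kineticEnergy (u t) ≤ K`,
one has `kineticEnergy (u t) ≤ E` for all `t ≥ 0`. Why true: every `t ≥ 0` lies within `L` after a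
control time `t₀` (a good time of energy `≤ K`, or `t₀ = 0` with `energy_ineq_zero`); dropping the
dissipation (`ν > 0`), `‖u(s)‖₂² ≤ 2K + 2∫_{t₀}^{s} ∫⟪f, u⟫ ≤ 2K + 2‖f‖_∞ ∫_{t₀}^{s} ‖u(τ)‖₂ dτ`;
`m := sup_{s ∈ [t₀, t₀+L]} ‖u(s)‖₂` is finite a priori (`energy_bound`: `u ∈ L^∞_t L²_x`) and obeys
`m² ≤ 2K + 2L‖f‖_∞ m`, so `m ≤ L‖f‖_∞ + (L²‖f‖²_∞ + 2K)^{1/2}` — independent of `ν` and of `u`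
(non-integrable work term: interval integral `0`, bound trivial). This is the precise sense in which
the summit's bounded-energy clause is a CONSEQUENCE of recurrence, not an extra assumption — in
contrast with the refuted universal ceiling GPEnergyCeiling (stmt-AnomalousDissipation-2979). Leans on:
`Literature.Analysis.FluidPDE.Torus.IsLerayHopfOn.{energy_ineq_zero, energy_bound, memLp}`,
`Literature.Analysis.FunctionSpaces.Torus.kineticEnergy_nonneg`, `intervalIntegral.integral_mono_on`,
`MeasureTheory.integral_inner_le`-type Hölder on the unit torus. Why it might fail: it should not
(DoeringFoias2002 §2 bookkeeping); the Lean work is the a-priori finiteness of `m` at EVERY slice and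
the junk cases of the Bochner/interval integrals. Sources: DoeringFoias2002, Hopf1951, Galdi2000. -/
theorem stub_energyBetweenVisits :
    ∀ (f : UnitAddTorus (Fin 3) → EuclideanSpace ℝ (Fin 3)) (L K : ℝ), Literature.Analysis.FunctionSpaces.Torus.IsSmooth f → 0 < L → ∃ E : ℝ, ∀ (ν : ℝ) (u₀ : UnitAddTorus (Fin 3) → EuclideanSpace ℝ (Fin 3)) (u : ℝ → UnitAddTorus (Fin 3) → EuclideanSpace ℝ (Fin 3)), 0 < ν → Literature.Analysis.FluidPDE.Torus.IsGlobalLerayHopf ν (fun _ => f) u₀ u → Literature.Analysis.FunctionSpaces.Torus.kineticEnergy u₀ ≤ K → (∀ T : ℝ, 0 ≤ T → ∃ t ∈ Set.Icc T (T + L), (∀ s : ℝ, t ≤ s → Literature.Analysis.FunctionSpaces.Torus.kineticEnergy (u s) + ν * (∫⁻ τ in Set.Ioo t s, Literature.Analysis.FunctionSpaces.Torus.eGradNormSq (u τ)).toReal ≤ Literature.Analysis.FunctionSpaces.Torus.kineticEnergy (u t) + ∫ τ in t..s, ∫ x, inner ℝ (f x) (u τ x)) ∧ Literature.Analysis.FunctionSpaces.Torus.kineticEnergy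 (u t) ≤ K) → ∀ t : ℝ, 0 ≤ t → Literature.Analysis.FunctionSpaces.Torus.kineticEnergy (u t) ≤ E := by
  sorry

/-! ## Name-keyed aliases of the three stub statements — the hypotheses of `RecurrentDebris_of`

The native skeleton audit (`#h21_check_skeleton`, run by `ledger skeleton check`) admits a hypothesis of
the composing theorem only if its head constant is a registered obligation or is NAMED like a declared
stub; `__Registered.stub_X` is the statement of `stub_X` verbatim under the stub's short name (device of
`Cruxes/CyclicWindLineLoud/Lines/birth.lean`, `Cruxes/MirrorFloorTG/Lines/birth.lean`; the `__`
namespace is an implementation detail, so the audit's stub report resolves each `stub_…` to the sorried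
theorem above, not to its alias). Each alias is an `abbrev`, textually its stub's signature. -/
namespace __Registered

/-- Alias of the statement of `stub_debrisCycle` (recurrent arrested collapse, `ν`-by-`ν`), keyed by the stub name. -/
abbrev stub_debrisCycle : Prop :=
  ∃ (α : ℝ) (W : EuclideanSpace ℝ (Fin 3) → EuclideanSpace ℝ (Fin 3)) (f : UnitAddTorus (Fin 3) → EuclideanSpace ℝ (Fin 3)) (M c L K ν₀ : ℝ), 2/3 < α ∧ α < 1 ∧ (ContDiff ℝ ((⊤ : ℕ∞) : WithTop ℕ∞) W ∧ ∃ y : EuclideanSpace ℝ (Fin 3), y ≠ 0 ∧ Literature.Analysis.FluidPDE.curl (fun z : EuclideanSpace ℝ (Fin 3) => (‖z‖ ^ (1 - α)) • W (‖z‖⁻¹ • z)) y ≠ 0) ∧ Literature.Analysis.FunctionSpaces.Torus.IsSmooth f ∧ Literature.Analysis.FunctionSpaces.Torus.IsDivFree f ∧ Literature.Analysis.FunctionSpaces.Torus.HasZeroMean f ∧ 0 < L ∧ 0 < ν₀ ∧ ∀ ν : ℝ, 0 < ν → ν ≤ ν₀ → ∃ (u₀ : UnitAddTorus (Fin 3)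 → EuclideanSpace ℝ (Fin 3)) (u : ℝ → UnitAddTorus (Fin 3) → EuclideanSpace ℝ (Fin 3)), Literature.Analysis.FluidPDE.Torus.IsGlobalLerayHopf ν (fun _ => f) u₀ u ∧ Literature.Analysis.FunctionSpaces.Torus.kineticEnergy u₀ ≤ K ∧ ∀ T : ℝ, 0 ≤ T → ∃ t ∈ Set.Icc T (T + L), ∃ (a : UnitAddTorus (Fin 3)) (b : UnitAddTorus (Fin 3) → EuclideanSpace ℝ (Fin 3)), (∀ s : ℝ, t ≤ s → Literature.Analysis.FunctionSpaces.Torus.kineticEnergy (u s) + ν * (∫⁻ τ in Set.Ioo t s, Literature.Analysis.FunctionSpaces.Torus.eGradNormSq (u τ)).toReal ≤ Literature.Analysis.FunctionSpaces.Torus.kineticEnergy (u t) + ∫ τ in t..s, ∫ x, inner ℝ (f x) (u τ x)) ∧ (Literature.Analysis.FunctionSpaces.Torus.IsSmooth b ∧ Literature.Analysis.FunctionSpaces.Torus.IsDivFree b ∧ ∀ y : EuclideanSpace ℝ (Fin 3), ‖Literature.Analysis.FunctionSpaces.Torus.lift b y‖ ≤ M ∧ ‖fderiv ℝ (Literature.Analysis.FunctionSpaces.Torus.lift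 b) y‖ ≤ M) ∧ MeasureTheory.eLpNorm (fun x => u t x - b x - Literature.Analysis.FluidPDE.curl (fun z : EuclideanSpace ℝ (Fin 3) => (Real.smoothTransition (2 - 8 * ‖z‖) * ‖z‖ ^ (1 - α)) • W (‖z‖⁻¹ • z)) (Literature.Analysis.FunctionSpaces.Torus.repr (x - a) - (!₂[(1:ℝ)/2, 1/2, 1/2] : EuclideanSpace ℝ (Fin 3)))) 2 MeasureTheory.volume ≤ ENNReal.ofReal (c * ν ^ ((3 - 2 * α) / (2 * (1 - α))))

/-- Alias of the statement of `stub_debrisStateEnergy` (energy of a debris state), keyed by the stub name. -/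
abbrev stub_debrisStateEnergy : Prop :=
  ∀ (α : ℝ) (W : EuclideanSpace ℝ (Fin 3) → EuclideanSpace ℝ (Fin 3)) (M c : ℝ), α < 1 → (ContDiff ℝ ((⊤ : ℕ∞) : WithTop ℕ∞) W ∧ ∃ y : EuclideanSpace ℝ (Fin 3), y ≠ 0 ∧ Literature.Analysis.FluidPDE.curl (fun z : EuclideanSpace ℝ (Fin 3) => (‖z‖ ^ (1 - α)) • W (‖z‖⁻¹ • z)) y ≠ 0) → ∃ K : ℝ, ∀ (ν : ℝ) (v : UnitAddTorus (Fin 3) → EuclideanSpace ℝ (Fin 3)) (a : UnitAddTorus (Fin 3)) (b : UnitAddTorus (Fin 3) → EuclideanSpace ℝ (Fin 3)), 0 < ν → ν ≤ 1 → MeasureTheory.MemLp v 2 MeasureTheory.volume → (Literature.Analysis.FunctionSpaces.Torus.IsSmooth b ∧ Literature.Analysis.FunctionSpaces.Torus.IsDivFree b ∧ ∀ y : EuclideanSpace ℝ (Fin 3), ‖Literature.Analysis.FunctionSpaces.Torus.lift b y‖ ≤ M ∧ ‖fderiv ℝ (Literature.Analysis.FunctionSpaces.Torus.lift b) y‖ ≤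 M) → MeasureTheory.eLpNorm (fun x => v x - b x - Literature.Analysis.FluidPDE.curl (fun z : EuclideanSpace ℝ (Fin 3) => (Real.smoothTransition (2 - 8 * ‖z‖) * ‖z‖ ^ (1 - α)) • W (‖z‖⁻¹ • z)) (Literature.Analysis.FunctionSpaces.Torus.repr (x - a) - (!₂[(1:ℝ)/2, 1/2, 1/2] : EuclideanSpace ℝ (Fin 3)))) 2 MeasureTheory.volume ≤ ENNReal.ofReal (c * ν ^ ((3 - 2 * α) / (2 * (1 - α)))) → Literature.Analysis.FunctionSpaces.Torus.kineticEnergy v ≤ K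

/-- Alias of the statement of `stub_energyBetweenVisits` (ν-uniform energy ceiling from recurrence), keyed by the stub name. -/
abbrev stub_energyBetweenVisits : Prop :=
  ∀ (f : UnitAddTorus (Fin 3) → EuclideanSpace ℝ (Fin 3)) (L K : ℝ), Literature.Analysis.FunctionSpaces.Torus.IsSmooth f → 0 < L → ∃ E : ℝ, ∀ (ν : ℝ) (u₀ : UnitAddTorus (Fin 3) → EuclideanSpace ℝ (Fin 3)) (u : ℝ → UnitAddTorus (Fin 3) → EuclideanSpace ℝ (Fin 3)), 0 < ν → Literature.Analysis.FluidPDE.Torus.IsGlobalLerayHopf ν (fun _ => f) u₀ u → Literature.Analysis.FunctionSpaces.Torus.kineticEnergy u₀ ≤ K → (∀ T : ℝ, 0 ≤ T → ∃ t ∈ Set.Icc T (T + L), (∀ s : ℝ, t ≤ s → Literature.Analysis.FunctionSpaces.Torus.kineticEnergy (u s) + ν * (∫⁻ τ in Set.Ioo t s, Literature.Analysis.FunctionSpaces.Torus.eGradNormSq (u τ)).toReal ≤ Literature.Analysis.FunctionSpaces.Torus.kineticEnergy (u t) + ∫ τ in t..s, ∫ x, inner ℝ (f x) (u τ x)) ∧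 Literature.Analysis.FunctionSpaces.Torus.kineticEnergy (u t) ≤ K) → ∀ t : ℝ, 0 ≤ t → Literature.Analysis.FunctionSpaces.Torus.kineticEnergy (u t) ≤ E

end __Registered

/-- **Composition** (kernel-checked, no `sorry` of its own): the three stub statements (as the
name-keyed aliases `__Registered.stub_*`) imply the crux
`Summit.AnomalousDissipation.AnomalousDissipation.Theses.DebrisQuanta.RecurrentDebris` BY NAME.
Sequence `ν_j := min ν₀ 1 / (j + 1)`; solutions chosen along it from stub 1; the energy level of a
debris visit is stub 2's `K₁`, the ceiling is stub 3's `E(f, L, max K K₁)`; the recurrence clause is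
stub 1's verbatim. [bookkeeping] -/
theorem RecurrentDebris_of :
    __Registered.stub_debrisCycle → __Registered.stub_debrisStateEnergy →
      __Registered.stub_energyBetweenVisits →
        Summit.AnomalousDissipation.AnomalousDissipation.Theses.DebrisQuanta.RecurrentDebris := by
  intro hCycle hState hBetween
  dsimp only [__Registered.stub_debrisCycle, __Registered.stub_debrisStateEnergy,
    __Registered.stub_energyBetweenVisits] at hCycle hState hBetween
  obtain ⟨α, W, f, M, c, L, K, ν₀, hα₁, hα₂, hAdm, hf, hfd, hfm, hL, hν₀, hfam⟩ := hCycle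
  -- energy level of a debris state (stub 2) and the ν-uniform ceiling (stub 3)
  obtain ⟨K₁, hK₁⟩ := hState α W M c hα₂ hAdm
  obtain ⟨E, hE⟩ := hBetween f L (max K K₁) hf hL
  -- the viscosity sequence `ν_j := μ / (j + 1)`, `μ := min ν₀ 1`
  set μ : ℝ := min ν₀ 1 with hμ
  have hμ0 : 0 < μ := lt_min hν₀ one_pos
  have hpos : ∀ j : ℕ, 0 < μ / ((j : ℝ) + 1) := fun j => by positivity
  have hle : ∀ j : ℕ, μ / ((j : ℝ) + 1) ≤ μ := fun j => by
    rw [div_le_iff₀ (by positivity)]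
    have hj : (0 : ℝ) ≤ (j : ℝ) := Nat.cast_nonneg j
    nlinarith
  have hle₀ : ∀ j : ℕ, μ / ((j : ℝ) + 1) ≤ ν₀ := fun j => (hle j).trans (min_le_left _ _)
  have hle₁ : ∀ j : ℕ, μ / ((j : ℝ) + 1) ≤ 1 := fun j => (hle j).trans (min_le_right _ _)
  -- choose the solutions of stub 1 along the sequence
  choose u₀ u hLH hKE hvis using fun j : ℕ => hfam (μ / ((j : ℝ) + 1)) (hpos j) (hle₀ j)
  unfold Summit.AnomalousDissipation.AnomalousDissipation.Theses.DebrisQuanta.RecurrentDebris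
  refine ⟨α, W, f, M, c, L, E, fun j => μ / ((j : ℝ) + 1), u₀, u, hα₁, hα₂, hAdm, hf, hfd, hfm, hL,
    hpos, ?_, hLH, ?_, ?_⟩
  · -- `ν_j → 0`
    exact tendsto_const_nhds.div_atTop
      (tendsto_atTop_add_const_right _ _ tendsto_natCast_atTop_atTop)
  · -- the energy ceiling: stub 3, fed with the visits of stub 1 whose energy stub 2 bounds
    intro j t ht
    refine hE _ (u₀ j) (u j) (hpos j) (hLH j) ((hKE j).trans (le_max_left _ _)) ?_ t ht
    intro T hT
    obtain ⟨s, hs, a, b, hgood, hbg, htol⟩ := hvis j T hT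
    have hs0 : 0 ≤ s := hT.trans hs.1
    have hmem : MeasureTheory.MemLp (u j s) 2 MeasureTheory.volume :=
      (hLH j (s + 1) (by linarith)).memLp s ⟨hs0, by linarith⟩
    exact ⟨s, hs, hgood, (hK₁ _ (u j s) a b (hpos j) (hle₁ j) hmem hbg htol).trans (le_max_right _ _)⟩
  · -- the recurrence clause: stub 1 verbatim
    intro j T hT
    exact hvis j T hT

/-- WIRING CHECK: the three sorried stubs compose to a closed term of the crux's type (modulo their
`sorry`s). Deliberately an `example` (no constant enters the environment). -/
example : Summit.AnomalousDissipation.AnomalousDissipation.Theses.DebrisQuanta.RecurrentDebris :=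
  RecurrentDebris_of stub_debrisCycle stub_debrisStateEnergy stub_energyBetweenVisits

end Summit.AnomalousDissipation.AnomalousDissipation.Cruxes.RecurrentDebris.Birth

end
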